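import Mathlib.Analysis.SpecialFunctions.SmoothTransition
import Mathlib.Analysis.SpecialFunctions.Sqrt
import Mathlib.Analysis.InnerProductSpace.Calculus
import Mathlib.Analysis.Calculus.Deriv.Slope
import Literature.Barriers.QuantumFields.NoClassicalGlueballsSlices
import HarnessLib

/-!
# Decay of classical Yang–Mills fields: the cone estimate (proofs)

Sibling proof file of `Literature/Barriers/QuantumFields/NoClassicalGlueballs.lean` (barrier
catalogue D-0021, summit `QuantumFields`), towards the named fact `GlasseyStraussLocalEnergyDecay`
(Glassey–Strauss, CMP 65 (1979), §4 Theorem). This file contains the one analytic step of the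
proof, in abstract form and without any reference to Yang–Mills theory: a **domain-of-dependence
(cone) estimate for a nonnegative density with outgoing flux**.

Glassey–Strauss integrate the inversional identity (13) "over all space" (p. 6), tacitly assuming
enough decay at spatial infinity at all times, and then restrict (15) `∫ (t − r)² e dx ≤ const` to
the cone `|x| ≤ R + (1 − ε)t` (p. 7). The vendored statement `GlasseyStraussLocalEnergyDecay` only
assumes `∫ r² e dx < ∞` at one time `t₀`; the rigorous replacement, as in their own cone
computations on p. 6 ("Integrate (e) over the 4-dimensional region `{|x| < t < T}` … The integrand
on the left is nonnegative"), is to integrate (13) over truncated backward cones, i.e. to bound the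
charge in a ball at time `t` by the total charge at time `t₀` using only the sign of the flux
through the cone mantle. We implement this with a smooth moving cutoff instead of a sharp cone:

* `χ_a(u) = Real.smoothTransition (a + 1 − u)` (`= 1` for `u ≤ a`, `= 0` for `u ≥ a + 1`,
  non-increasing) and the weight `y ↦ χ_a(⟨y⟩ + s)`, `⟨y⟩ = √(1 + |y|²)` (smooth, compactly
  supported in `y`, moving inward at speed `1`; `∂_{y_i} χ_a(⟨y⟩ + s) = χ_a'(⟨y⟩ + s) y_i/⟨y⟩`);
* `hasDerivAt_coneCharge`: for jointly smooth `q, g₁, g₂, g₃ : ℝ × ℝ³ → ℝ` with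
  `∂_s q + Σ_i ∂_{y_i} g_i = 0`, the charge `M(s) = ∫ χ_a(⟨y⟩ + s) q(s, y) dy` has
  `M'(s) = ∫ χ_a'(⟨y⟩ + s) ⟨y⟩⁻¹ (⟨y⟩ q + Σ_i y_i g_i)(s, y) dy` (differentiation under the
  integral sign — the tree's `FluidPDE.hasDerivAt_integral_of_support_subset` — then integration by
  parts on `ℝ³`, `NoClassicalGlueballsSlices.integral_mul_fderiv_eq_neg`);
* `coneCharge_antitoneOn`: if the flux is outgoing, `0 ≤ ⟨y⟩ q + Σ_i y_i g_i` for `s ≥ t₀`, then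
  `M` is non-increasing on `[t₀, ∞)`;
* `setIntegral_closedBall_le_integral_of_flux`: if moreover `q ≥ 0` for `s ≥ t₀` and `q(t₀, ·)`
  is integrable, then `∫_{|y| ≤ ρ} q(t, y) dy ≤ ∫ q(t₀, y) dy` for all `t ≥ t₀`, `ρ` (take
  `a = ⟨ρ⟩ + t`, so that the weight is `1` on the ball at time `t` and `≤ 1` at time `t₀`).

Applied (next file) to `q = J⁰`, `g_i = Jⁱ`, the inversional current of a Yang–Mills field, whose
flux is outgoing by `NoClassicalGlueballsFluxPositivityProofs.conformalCurrent_flux_nonneg`, this is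
the localised form of Glassey–Strauss (15).

## References

* R. T. Glassey, W. A. Strauss, *Decay of classical Yang–Mills fields*, Commun. Math. Phys. 65
  (1979) 1–13, §4, pp. 6–7, (15) [GlasseyStrauss1979].
* L. C. Evans, *Partial Differential Equations*, 2nd ed. (2010), §2.4.3 (domain of dependence by
  the energy method on cones) — the standard form of the argument.
-/

noncomputable section

open MeasureTheory Set Filter Topology Function Metric
open scoped ContDiff

namespace Literature.Barriers.QuantumFields

open Literature.Analysis.FluidPDE

/-! ### The bracket `⟨y⟩ = √(1 + |y|²)` -/

section Bracket

variable {X : Type*} [NormedAddCommGroup X] [InnerProductSpace ℝ X]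

/-- `⟨y⟩ = √(1 + |y|²)` is smooth. [folklore] -/
theorem contDiff_sqrt_one_add_norm_sq {n : WithTop ℕ∞} :
    ContDiff ℝ n fun y : X => √(1 + ‖y‖ ^ 2) :=
  (contDiff_const.add (contDiff_norm_sq ℝ)).sqrt fun y => by positivity

omit [InnerProductSpace ℝ X] in
/-- `1 ≤ ⟨y⟩`. [folklore] -/
theorem one_le_sqrt_one_add_norm_sq [NormedSpace ℝ X] (y : X) : 1 ≤ √(1 + ‖y‖ ^ 2) := by
  rw [Real.le_sqrt' one_pos]
  nlinarith [norm_nonneg y]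

omit [InnerProductSpace ℝ X] in
/-- `0 < ⟨y⟩`. [folklore] -/
theorem sqrt_one_add_norm_sq_pos [NormedSpace ℝ X] (y : X) : 0 < √(1 + ‖y‖ ^ 2) :=
  one_pos.trans_le (one_le_sqrt_one_add_norm_sq y)

omit [InnerProductSpace ℝ X] in
/-- `|y| ≤ ⟨y⟩`. [folklore] -/
theorem norm_le_sqrt_one_add_norm_sq' [NormedSpace ℝ X] (y : X) : ‖y‖ ≤ √(1 + ‖y‖ ^ 2) :=
  calc ‖y‖ = √(‖y‖ ^ 2) := (Real.sqrt_sq (norm_nonneg _)).symm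
    _ ≤ √(1 + ‖y‖ ^ 2) := Real.sqrt_le_sqrt (by linarith)

/-- The derivative of the bracket: `d⟨y⟩ = ⟨y⟩⁻¹ ⟪y, ·⟫`. [folklore] -/
theorem hasFDerivAt_sqrt_one_add_norm_sq (y : X) :
    HasFDerivAt (fun z : X => √(1 + ‖z‖ ^ 2)) ((√(1 + ‖y‖ ^ 2))⁻¹ • innerSL ℝ y) y := by
  have h := ((hasStrictFDerivAt_norm_sq y).hasFDerivAt.const_add 1).sqrt (by positivity)
  refine h.congr_fderiv ?_
  rw [← Nat.cast_smul_eq_nsmul ℝ 2 (innerSL ℝ y), smul_smul]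
  congr 1
  have := sqrt_one_add_norm_sq_pos y
  push_cast
  field_simp

/-- `∂_v ⟨y⟩ = ⟪y, v⟫ / ⟨y⟩`. [folklore] -/
theorem fderiv_sqrt_one_add_norm_sq_apply (y v : X) :
    fderiv ℝ (fun z : X => √(1 + ‖z‖ ^ 2)) y v = inner ℝ y v / √(1 + ‖y‖ ^ 2) := by
  rw [(hasFDerivAt_sqrt_one_add_norm_sq y).fderiv, smul_apply, innerSL_apply_apply, smul_eq_mul,
    div_eq_inv_mul]

end Bracket

/-! ### The cutoff profile `χ_a(u) = smoothTransition (a + 1 − u)` -/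

section Profile

/-- The profile is smooth. [folklore] -/
theorem contDiff_coneProfile (a : ℝ) {n : ℕ∞} :
    ContDiff ℝ n fun u : ℝ => Real.smoothTransition (a + 1 - u) :=
  Real.smoothTransition.contDiff.comp (contDiff_const.sub contDiff_id)

/-- `χ_a(u) = 1` for `u ≤ a`. [folklore] -/
theorem coneProfile_eq_one {a u : ℝ} (h : u ≤ a) : Real.smoothTransition (a + 1 - u) = 1 :=
  Real.smoothTransition.one_of_one_le (by linarith)

/-- `χ_a(u) = 0` for `a + 1 ≤ u`. [folklore] -/
theorem coneProfile_eq_zero {a u : ℝ} (h : a + 1 ≤ u) : Real.smoothTransition (a + 1 - u) = 0 :=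
  Real.smoothTransition.zero_of_nonpos (by linarith)

/-- `0 ≤ χ_a ≤ 1`. [folklore] -/
theorem coneProfile_nonneg (a u : ℝ) : 0 ≤ Real.smoothTransition (a + 1 - u) :=
  Real.smoothTransition.nonneg _

/-- `χ_a ≤ 1`. [folklore] -/
theorem coneProfile_le_one (a u : ℝ) : Real.smoothTransition (a + 1 - u) ≤ 1 :=
  Real.smoothTransition.le_one _

/-- The derivative of the profile: `χ_a'(u) = −smoothTransition'(a + 1 − u)`. [folklore] -/
theorem hasDerivAt_coneProfile (a u : ℝ) :
    HasDerivAt (fun v : ℝ => Real.smoothTransition (a + 1 - v))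
      (-deriv Real.smoothTransition (a + 1 - u)) u := by
  have h1 : HasDerivAt Real.smoothTransition (deriv Real.smoothTransition (a + 1 - u)) (a + 1 - u) :=
    ((Real.smoothTransition.contDiff (n := ⊤)).differentiable (by simp) _).hasDerivAt
  have h2 : HasDerivAt (fun v : ℝ => a + 1 - v) (-1) u := by
    simpa using (hasDerivAt_id u).const_sub (a + 1)
  have h3 := h1.comp u h2
  rw [mul_neg_one] at h3
  exact h3

/-- The profile is non-increasing: `χ_a' ≤ 0`. [folklore] -/
theorem deriv_coneProfile_nonpos (a u : ℝ) :
    deriv (fun v : ℝ => Real.smoothTransition (a + 1 - v)) u ≤ 0 := by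
  rw [(hasDerivAt_coneProfile a u).deriv, neg_nonpos]
  exact Real.smoothTransition.monotone.deriv_nonneg

/-- `χ_a' = 0` on `(a + 1, ∞)` (where `χ_a ≡ 0`). [folklore] -/
theorem deriv_coneProfile_eq_zero {a u : ℝ} (h : a + 1 < u) :
    deriv (fun v : ℝ => Real.smoothTransition (a + 1 - v)) u = 0 := by
  have he : (fun v : ℝ => Real.smoothTransition (a + 1 - v)) =ᶠ[𝓝 u] fun _ => 0 := by
    filter_upwards [lt_mem_nhds h] with v hv
    exact coneProfile_eq_zero hv.le
  rw [he.deriv_eq, deriv_const]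

end Profile

/-! ### The moving cutoff `y ↦ χ_a(⟨y⟩ + s)` -/

section MovingCutoff

variable (a s : ℝ)

/-- Outside the ball of radius `a + 1 − s` the moving cutoff vanishes. [folklore] -/
theorem coneProfile_bracket_eq_zero {a s : ℝ} {y : (EuclideanSpace ℝ (Fin 3))} (hy : a + 1 - s < ‖y‖) :
    Real.smoothTransition (a + 1 - (√(1 + ‖y‖ ^ 2) + s)) = 0 :=
  coneProfile_eq_zero (by linarith [norm_le_sqrt_one_add_norm_sq' y])

/-- … and so does its derivative. [folklore] -/
theorem deriv_coneProfile_bracket_eq_zero {a s : ℝ} {y : (EuclideanSpace ℝ (Fin 3))} (hy : a + 1 - s < ‖y‖) :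
    deriv (fun v : ℝ => Real.smoothTransition (a + 1 - v)) (√(1 + ‖y‖ ^ 2) + s) = 0 :=
  deriv_coneProfile_eq_zero (by linarith [norm_le_sqrt_one_add_norm_sq' y])

/-- On the ball of radius `ρ`, at time `s`, the cutoff with `a = ⟨ρ⟩ + s`… is `1`: precisely, if
`⟨y⟩ + s ≤ a` then `χ_a(⟨y⟩ + s) = 1`. [folklore] -/
theorem coneProfile_bracket_eq_one {a s : ℝ} {y : (EuclideanSpace ℝ (Fin 3))} (hy : √(1 + ‖y‖ ^ 2) + s ≤ a) :
    Real.smoothTransition (a + 1 - (√(1 + ‖y‖ ^ 2) + s)) = 1 :=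
  coneProfile_eq_one hy

/-- The moving cutoff is jointly smooth in `(s, y)`. [folklore] -/
theorem contDiff_coneProfile_bracket_uncurry (a : ℝ) :
    ContDiff ℝ ∞ fun p : ℝ × (EuclideanSpace ℝ (Fin 3)) => Real.smoothTransition (a + 1 - (√(1 + ‖p.2‖ ^ 2) + p.1)) :=
  (contDiff_coneProfile a).comp ((contDiff_sqrt_one_add_norm_sq.comp contDiff_snd).add contDiff_fst)

/-- The moving cutoff is smooth in `y`. [folklore] -/
theorem contDiff_coneProfile_bracket (a s : ℝ) {n : ℕ∞} :
    ContDiff ℝ n fun y : (EuclideanSpace ℝ (Fin 3)) => Real.smoothTransition (a + 1 - (√(1 + ‖y‖ ^ 2) + s)) :=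
  (contDiff_coneProfile a).comp (contDiff_sqrt_one_add_norm_sq.add contDiff_const)

/-- The moving cutoff has compact support in `y`. [folklore] -/
theorem hasCompactSupport_coneProfile_bracket (a s : ℝ) :
    HasCompactSupport fun y : (EuclideanSpace ℝ (Fin 3)) => Real.smoothTransition (a + 1 - (√(1 + ‖y‖ ^ 2) + s)) := by
  refine HasCompactSupport.intro (isCompact_closedBall (0 : EuclideanSpace ℝ (Fin 3)) (a + 1 - s)) fun y hy => ?_
  rw [mem_closedBall, dist_zero_right, not_le] at hy
  exact coneProfile_bracket_eq_zero hy

/-- The derivative factor of the moving cutoff has compact support in `y`. [folklore] -/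
theorem hasCompactSupport_deriv_coneProfile_bracket (a s : ℝ) :
    HasCompactSupport fun y : (EuclideanSpace ℝ (Fin 3)) =>
      deriv (fun v : ℝ => Real.smoothTransition (a + 1 - v)) (√(1 + ‖y‖ ^ 2) + s) := by
  refine HasCompactSupport.intro (isCompact_closedBall (0 : EuclideanSpace ℝ (Fin 3)) (a + 1 - s)) fun y hy => ?_
  rw [mem_closedBall, dist_zero_right, not_le] at hy
  exact deriv_coneProfile_bracket_eq_zero hy

/-- The derivative factor is continuous in `y`. [folklore] -/
theorem continuous_deriv_coneProfile_bracket (a s : ℝ) :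
    Continuous fun y : (EuclideanSpace ℝ (Fin 3)) =>
      deriv (fun v : ℝ => Real.smoothTransition (a + 1 - v)) (√(1 + ‖y‖ ^ 2) + s) :=
  ((contDiff_coneProfile a (n := ⊤)).continuous_deriv (by simp)).comp
    ((contDiff_sqrt_one_add_norm_sq (n := 0)).continuous.add continuous_const)

/-- **Spatial gradient of the moving cutoff**: `∂_{y_i} χ_a(⟨y⟩ + s) = χ_a'(⟨y⟩ + s) y_i / ⟨y⟩`.
[folklore] -/
theorem fderiv_coneProfile_bracket_single (a s : ℝ) (y : (EuclideanSpace ℝ (Fin 3))) (i : Fin 3) :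
    fderiv ℝ (fun z : (EuclideanSpace ℝ (Fin 3)) => Real.smoothTransition (a + 1 - (√(1 + ‖z‖ ^ 2) + s))) y
        (EuclideanSpace.single i 1) =
      deriv (fun v : ℝ => Real.smoothTransition (a + 1 - v)) (√(1 + ‖y‖ ^ 2) + s) *
        (y i / √(1 + ‖y‖ ^ 2)) := by
  have h1 := hasDerivAt_coneProfile a (√(1 + ‖y‖ ^ 2) + s)
  have h2 := (hasFDerivAt_sqrt_one_add_norm_sq y).add_const s
  have h := h1.comp_hasFDerivAt y h2
  have h' : HasFDerivAt (fun z : (EuclideanSpace ℝ (Fin 3)) => Real.smoothTransition (a + 1 - (√(1 + ‖z‖ ^ 2) + s)))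
      ((-deriv Real.smoothTransition (a + 1 - (√(1 + ‖y‖ ^ 2) + s))) •
        ((√(1 + ‖y‖ ^ 2))⁻¹ • innerSL ℝ y)) y := h
  rw [h'.fderiv, h1.deriv, smul_apply, smul_apply, innerSL_apply_apply,
    EuclideanSpace.inner_single_right, smul_eq_mul, smul_eq_mul]
  simp [div_eq_inv_mul]

/-- **Time derivative of the moving cutoff**: `∂_s χ_a(⟨y⟩ + s) = χ_a'(⟨y⟩ + s)`. [folklore] -/
theorem hasDerivAt_coneProfile_bracket (a s : ℝ) (y : (EuclideanSpace ℝ (Fin 3))) :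
    HasDerivAt (fun s' : ℝ => Real.smoothTransition (a + 1 - (√(1 + ‖y‖ ^ 2) + s')))
      (deriv (fun v : ℝ => Real.smoothTransition (a + 1 - v)) (√(1 + ‖y‖ ^ 2) + s)) s := by
  have h1 := hasDerivAt_coneProfile a (√(1 + ‖y‖ ^ 2) + s)
  have h := h1.comp s ((hasDerivAt_id s).const_add (√(1 + ‖y‖ ^ 2)))
  rw [mul_one] at h
  rw [h1.deriv]
  exact h

/-- Integrability of `χ_a(⟨y⟩ + s) h(y)` for continuous `h`. [folklore] -/
theorem integrable_coneProfile_bracket_mul (a s : ℝ) {h : (EuclideanSpace ℝ (Fin 3)) → ℝ} (hh : Continuous h) :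
    Integrable fun y : (EuclideanSpace ℝ (Fin 3)) => Real.smoothTransition (a + 1 - (√(1 + ‖y‖ ^ 2) + s)) * h y :=
  ((contDiff_coneProfile_bracket a s (n := 0)).continuous.mul hh).integrable_of_hasCompactSupport
    (hasCompactSupport_coneProfile_bracket a s).mul_right

/-- Integrability of `χ_a'(⟨y⟩ + s) h(y)` for continuous `h`. [folklore] -/
theorem integrable_deriv_coneProfile_bracket_mul (a s : ℝ) {h : (EuclideanSpace ℝ (Fin 3)) → ℝ} (hh : Continuous h) :
    Integrable fun y : (EuclideanSpace ℝ (Fin 3)) =>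
      deriv (fun v : ℝ => Real.smoothTransition (a + 1 - v)) (√(1 + ‖y‖ ^ 2) + s) * h y :=
  ((continuous_deriv_coneProfile_bracket a s).mul hh).integrable_of_hasCompactSupport
    (hasCompactSupport_deriv_coneProfile_bracket a s).mul_right

end MovingCutoff

/-! ### The cone charge and its time derivative -/

section ConeCharge

/-- Slices of a jointly `C^n` field are `C^n`. [folklore] -/
theorem contDiff_slice' {n : WithTop ℕ∞} {w : ℝ → (EuclideanSpace ℝ (Fin 3)) → ℝ} (hw : ContDiff ℝ n (uncurry w)) (s : ℝ) :
    ContDiff ℝ n (w s) :=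
  hw.comp (contDiff_prodMk_right s)

/-- Time lines of a jointly `C^n` field are `C^n`. [folklore] -/
theorem contDiff_timeLine' {n : WithTop ℕ∞} {w : ℝ → (EuclideanSpace ℝ (Fin 3)) → ℝ} (hw : ContDiff ℝ n (uncurry w))
    (y : (EuclideanSpace ℝ (Fin 3))) : ContDiff ℝ n fun s => w s y :=
  hw.comp (contDiff_prodMk_left y)

variable {q : ℝ → (EuclideanSpace ℝ (Fin 3)) → ℝ} {g : Fin 3 → ℝ → (EuclideanSpace ℝ (Fin 3)) → ℝ}

/-- **Time derivative of the cone charge.** For jointly smooth `q`, `g_i` satisfying the local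
conservation law `∂_s q + Σ_i ∂_{y_i} g_i = 0`, the weighted charge
`M(s) = ∫ χ_a(⟨y⟩ + s) q(s, y) dy` is differentiable with
`M'(s) = ∫ χ_a'(⟨y⟩ + s) ⟨y⟩⁻¹ (⟨y⟩ q(s, y) + Σ_i y_i g_i(s, y)) dy`
(differentiate under the integral sign, insert the conservation law, integrate by parts; the
boundary flux of the sharp-cone computation of Glassey–Strauss p. 6 becomes the bulk term
supported in the transition shell of the cutoff). [cite: GlasseyStrauss1979, §4 (p. 6)] -/
theorem hasDerivAt_coneCharge (hq : ContDiff ℝ ∞ (uncurry q)) (hg : ∀ i, ContDiff ℝ ∞ (uncurry (g i)))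
    (hcons : ∀ s y, deriv (fun s' => q s' y) s +
      ∑ i, fderiv ℝ (g i s) y (EuclideanSpace.single i 1) = 0)
    (a s : ℝ) :
    HasDerivAt (fun s' => ∫ y : (EuclideanSpace ℝ (Fin 3)), Real.smoothTransition (a + 1 - (√(1 + ‖y‖ ^ 2) + s')) * q s' y)
      (∫ y : (EuclideanSpace ℝ (Fin 3)), deriv (fun v : ℝ => Real.smoothTransition (a + 1 - v)) (√(1 + ‖y‖ ^ 2) + s) /
          √(1 + ‖y‖ ^ 2) * (√(1 + ‖y‖ ^ 2) * q s y + ∑ i, y i * g i s y)) s := by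
  -- Step 1: differentiation under the integral sign on the time set `S = (s - 1, ∞)`
  set Φ : ℝ → (EuclideanSpace ℝ (Fin 3)) → ℝ :=
    fun s' y => Real.smoothTransition (a + 1 - (√(1 + ‖y‖ ^ 2) + s')) * q s' y with hΦ
  have hSo : IsOpen (Ioi (s - 1)) := isOpen_Ioi
  have hsS : s ∈ Ioi (s - 1) := by simp
  have hΦs : IsSmoothSpaceTimeOn (Ioi (s - 1)) Φ :=
    ((contDiff_coneProfile_bracket_uncurry a).mul hq).contDiffOn
  have hK : IsCompact (closedBall (0 : EuclideanSpace ℝ (Fin 3)) (a + 2 - s)) := isCompact_closedBall _ _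
  have hsupp : ∀ s' ∈ Ioi (s - 1), ∀ y ∉ closedBall (0 : EuclideanSpace ℝ (Fin 3)) (a + 2 - s), Φ s' y = 0 := by
    intro s' hs' y hy
    rw [mem_closedBall, dist_zero_right, not_le] at hy
    have hs'' : s - 1 < s' := hs'
    have h : a + 1 - s' < ‖y‖ := by linarith
    simp [hΦ, coneProfile_bracket_eq_zero h]
  have key := hasDerivAt_integral_of_support_subset (μ := (volume : Measure (EuclideanSpace ℝ (Fin 3)))) hSo hΦs hK
    hsupp hsS
  -- Step 2: the time derivative of the integrand, with the conservation law inserted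
  have hqs : ∀ s', ContDiff ℝ ∞ (q s') := contDiff_slice' hq
  have hgs : ∀ i s', ContDiff ℝ ∞ (g i s') := fun i => contDiff_slice' (hg i)
  have hderiv : ∀ y, deriv (fun s' => Φ s' y) s =
      deriv (fun v : ℝ => Real.smoothTransition (a + 1 - v)) (√(1 + ‖y‖ ^ 2) + s) * q s y -
        Real.smoothTransition (a + 1 - (√(1 + ‖y‖ ^ 2) + s)) *
          ∑ i, fderiv ℝ (g i s) y (EuclideanSpace.single i 1) := by
    intro y
    have hqt : HasDerivAt (fun s' => q s' y) (deriv (fun s' => q s' y) s) s :=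
      ((contDiff_timeLine' hq y).differentiable (by simp) s).hasDerivAt
    have h := ((hasDerivAt_coneProfile_bracket a s y).fun_mul hqt).deriv
    simp only [hΦ]
    rw [h, eq_neg_of_add_eq_zero_left (hcons s y)]
    ring
  -- Step 3: integrability of the pieces (compact support in `y`)
  have hc1 : ∀ i, Continuous fun y : (EuclideanSpace ℝ (Fin 3)) => fderiv ℝ (g i s) y (EuclideanSpace.single i 1) :=
    fun i => ((hgs i s).continuous_fderiv (by simp)).clm_apply continuous_const
  have hc2 : ∀ i, Continuous fun y : (EuclideanSpace ℝ (Fin 3)) => y i / √(1 + ‖y‖ ^ 2) * g i s y := fun i =>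
    (((PiLp.proj (𝕜 := ℝ) 2 (fun _ : Fin 3 => ℝ) i).continuous.div
      (contDiff_sqrt_one_add_norm_sq (n := 0)).continuous
      fun y => (sqrt_one_add_norm_sq_pos y).ne')).mul (hgs i s).continuous
  have hI1 := integrable_deriv_coneProfile_bracket_mul a s (hqs s).continuous
  have hI2 : ∀ i, Integrable fun y : (EuclideanSpace ℝ (Fin 3)) =>
      Real.smoothTransition (a + 1 - (√(1 + ‖y‖ ^ 2) + s)) *
        fderiv ℝ (g i s) y (EuclideanSpace.single i 1) := fun i =>
    integrable_coneProfile_bracket_mul a s (hc1 i)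
  have hI3 : ∀ i, Integrable fun y : (EuclideanSpace ℝ (Fin 3)) =>
      deriv (fun v : ℝ => Real.smoothTransition (a + 1 - v)) (√(1 + ‖y‖ ^ 2) + s) *
        (y i / √(1 + ‖y‖ ^ 2) * g i s y) := fun i =>
    integrable_deriv_coneProfile_bracket_mul a s (hc2 i)
  -- Step 4: integration by parts in each spatial direction
  have hibp : ∀ i, ∫ y : (EuclideanSpace ℝ (Fin 3)), Real.smoothTransition (a + 1 - (√(1 + ‖y‖ ^ 2) + s)) *
      fderiv ℝ (g i s) y (EuclideanSpace.single i 1) =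
      -∫ y : (EuclideanSpace ℝ (Fin 3)), deriv (fun v : ℝ => Real.smoothTransition (a + 1 - v)) (√(1 + ‖y‖ ^ 2) + s) *
        (y i / √(1 + ‖y‖ ^ 2) * g i s y) := by
    intro i
    rw [integral_mul_fderiv_eq_neg (contDiff_coneProfile_bracket a s) (hasCompactSupport_coneProfile_bracket a s)
      ((hgs i s).of_le (by exact_mod_cast le_top)) (EuclideanSpace.single i 1)]
    congr 1
    refine integral_congr_ae (Eventually.of_forall fun y => ?_)
    simp only [fderiv_coneProfile_bracket_single]
    ring
  -- Step 5: assemble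
  refine key.congr_deriv ?_
  calc ∫ y : (EuclideanSpace ℝ (Fin 3)), deriv (fun s' => Φ s' y) s
      = ∫ y : (EuclideanSpace ℝ (Fin 3)), (deriv (fun v : ℝ => Real.smoothTransition (a + 1 - v)) (√(1 + ‖y‖ ^ 2) + s) * q s y -
          ∑ i, Real.smoothTransition (a + 1 - (√(1 + ‖y‖ ^ 2) + s)) *
            fderiv ℝ (g i s) y (EuclideanSpace.single i 1)) := by
        refine integral_congr_ae (Eventually.of_forall fun y => ?_)
        simp only [hderiv, Finset.mul_sum]
    _ = (∫ y : (EuclideanSpace ℝ (Fin 3)), deriv (fun v : ℝ => Real.smoothTransition (a + 1 - v)) (√(1 + ‖y‖ ^ 2) + s) * q s y) -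
          ∑ i, ∫ y : (EuclideanSpace ℝ (Fin 3)), Real.smoothTransition (a + 1 - (√(1 + ‖y‖ ^ 2) + s)) *
            fderiv ℝ (g i s) y (EuclideanSpace.single i 1) := by
        rw [integral_sub hI1 (integrable_finsetSum _ fun i _ => hI2 i),
          integral_finsetSum _ fun i _ => hI2 i]
    _ = (∫ y : (EuclideanSpace ℝ (Fin 3)), deriv (fun v : ℝ => Real.smoothTransition (a + 1 - v)) (√(1 + ‖y‖ ^ 2) + s) * q s y) +
          ∑ i, ∫ y : (EuclideanSpace ℝ (Fin 3)), deriv (fun v : ℝ => Real.smoothTransition (a + 1 - v)) (√(1 + ‖y‖ ^ 2) + s) *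
            (y i / √(1 + ‖y‖ ^ 2) * g i s y) := by
        simp only [hibp, Finset.sum_neg_distrib, sub_neg_eq_add]
    _ = ∫ y : (EuclideanSpace ℝ (Fin 3)), (deriv (fun v : ℝ => Real.smoothTransition (a + 1 - v)) (√(1 + ‖y‖ ^ 2) + s) * q s y +
          ∑ i, deriv (fun v : ℝ => Real.smoothTransition (a + 1 - v)) (√(1 + ‖y‖ ^ 2) + s) *
            (y i / √(1 + ‖y‖ ^ 2) * g i s y)) := by
        rw [integral_add hI1 (integrable_finsetSum _ fun i _ => hI3 i),
          integral_finsetSum _ fun i _ => hI3 i]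
    _ = _ := by
        refine integral_congr_ae (Eventually.of_forall fun y => ?_)
        have hb := (sqrt_one_add_norm_sq_pos y).ne'
        simp only [Finset.mul_sum, mul_add]
        congr 1
        · field_simp
        · exact Finset.sum_congr rfl fun i _ => by field_simp

/-- **Monotonicity of the cone charge.** If moreover the flux is outgoing for `s ≥ t₀`
(`0 ≤ ⟨y⟩ q(s, y) + Σ_i y_i g_i(s, y)`), the weighted charge `M(s) = ∫ χ_a(⟨y⟩ + s) q(s, y) dy`
is non-increasing on `[t₀, ∞)` (`χ_a' ≤ 0`). [cite: GlasseyStrauss1979, §4 (p. 6)] -/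
theorem coneCharge_antitoneOn (hq : ContDiff ℝ ∞ (uncurry q)) (hg : ∀ i, ContDiff ℝ ∞ (uncurry (g i)))
    (hcons : ∀ s y, deriv (fun s' => q s' y) s +
      ∑ i, fderiv ℝ (g i s) y (EuclideanSpace.single i 1) = 0)
    (t₀ : ℝ) (hflux : ∀ s, t₀ ≤ s → ∀ y : (EuclideanSpace ℝ (Fin 3)), 0 ≤ √(1 + ‖y‖ ^ 2) * q s y + ∑ i, y i * g i s y)
    (a : ℝ) :
    AntitoneOn (fun s' => ∫ y : (EuclideanSpace ℝ (Fin 3)), Real.smoothTransition (a + 1 - (√(1 + ‖y‖ ^ 2) + s')) * q s' y)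
      (Ici t₀) := by
  have hd := hasDerivAt_coneCharge hq hg hcons a
  refine antitoneOn_of_deriv_nonpos (convex_Ici t₀) (fun s _ => (hd s).continuousAt.continuousWithinAt)
    (fun s _ => (hd s).differentiableAt.differentiableWithinAt) fun s hs => ?_
  rw [interior_Ici] at hs
  rw [(hd s).deriv]
  refine integral_nonpos fun y => ?_
  have h1 := deriv_coneProfile_nonpos a (√(1 + ‖y‖ ^ 2) + s)
  have h2 := sqrt_one_add_norm_sq_pos y
  have h3 := hflux s (le_of_lt hs) y
  exact mul_nonpos_iff.2 (Or.inr ⟨div_nonpos_iff.2 (Or.inr ⟨h1, h2.le⟩), h3⟩)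

/-- **The cone estimate (abstract form of Glassey–Strauss (15) on truncated cones).** Let `q`,
`g_i` be jointly smooth on `ℝ × ℝ³` with `∂_s q + Σ_i ∂_{y_i} g_i = 0`, `q ≥ 0` and outgoing flux
`0 ≤ ⟨y⟩ q + Σ_i y_i g_i` for `s ≥ t₀`, and let `q(t₀, ·)` be integrable. Then for every
`t ≥ t₀` and every radius `ρ`, `∫_{|y| ≤ ρ} q(t, y) dy ≤ ∫ q(t₀, y) dy`: the charge in a ball at
time `t` is bounded by the total charge at time `t₀` (domain of dependence at speed `1`; the
moving cutoff `χ_a(⟨y⟩ + s)` with `a = ⟨ρ⟩ + t` equals `1` on the ball at time `t`).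
[cite: GlasseyStrauss1979, §4 (15)] -/
theorem setIntegral_closedBall_le_integral_of_flux (hq : ContDiff ℝ ∞ (uncurry q))
    (hg : ∀ i, ContDiff ℝ ∞ (uncurry (g i)))
    (hcons : ∀ s y, deriv (fun s' => q s' y) s +
      ∑ i, fderiv ℝ (g i s) y (EuclideanSpace.single i 1) = 0)
    {t₀ : ℝ} (hpos : ∀ s, t₀ ≤ s → ∀ y : (EuclideanSpace ℝ (Fin 3)), 0 ≤ q s y)
    (hflux : ∀ s, t₀ ≤ s → ∀ y : (EuclideanSpace ℝ (Fin 3)), 0 ≤ √(1 + ‖y‖ ^ 2) * q s y + ∑ i, y i * g i s y)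
    (hint : Integrable (q t₀)) {t : ℝ} (ht : t₀ ≤ t) (ρ : ℝ) :
    ∫ y in closedBall (0 : EuclideanSpace ℝ (Fin 3)) ρ, q t y ≤ ∫ y : (EuclideanSpace ℝ (Fin 3)), q t₀ y := by
  set a : ℝ := √(1 + ρ ^ 2) + t with ha
  have hqs : ∀ s', ContDiff ℝ ∞ (q s') := contDiff_slice' hq
  have hanti := coneCharge_antitoneOn hq hg hcons t₀ hflux a
  have h1 : ∫ y : (EuclideanSpace ℝ (Fin 3)), Real.smoothTransition (a + 1 - (√(1 + ‖y‖ ^ 2) + t)) * q t y ≤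
      ∫ y : (EuclideanSpace ℝ (Fin 3)), Real.smoothTransition (a + 1 - (√(1 + ‖y‖ ^ 2) + t₀)) * q t₀ y :=
    hanti (self_mem_Ici (a := t₀)) (mem_Ici.2 ht) ht
  have h2 : ∫ y : (EuclideanSpace ℝ (Fin 3)), Real.smoothTransition (a + 1 - (√(1 + ‖y‖ ^ 2) + t₀)) * q t₀ y ≤
      ∫ y : (EuclideanSpace ℝ (Fin 3)), q t₀ y :=
    integral_mono (integrable_coneProfile_bracket_mul a t₀ (hqs t₀).continuous) hint fun y =>
      mul_le_of_le_one_left (hpos t₀ le_rfl y) (coneProfile_le_one _ _)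
  have h3 : ∫ y in closedBall (0 : EuclideanSpace ℝ (Fin 3)) ρ, q t y ≤
      ∫ y : (EuclideanSpace ℝ (Fin 3)), Real.smoothTransition (a + 1 - (√(1 + ‖y‖ ^ 2) + t)) * q t y := by
    calc ∫ y in closedBall (0 : EuclideanSpace ℝ (Fin 3)) ρ, q t y
        = ∫ y in closedBall (0 : EuclideanSpace ℝ (Fin 3)) ρ,
            Real.smoothTransition (a + 1 - (√(1 + ‖y‖ ^ 2) + t)) * q t y := by
          refine setIntegral_congr_fun measurableSet_closedBall fun y hy => ?_
          rw [mem_closedBall, dist_zero_right] at hy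
          have hy2 : ‖y‖ ^ 2 ≤ ρ ^ 2 := by nlinarith [norm_nonneg y]
          have hle : √(1 + ‖y‖ ^ 2) + t ≤ a := by
            rw [ha]
            gcongr
          simp only [coneProfile_bracket_eq_one hle, one_mul]
      _ ≤ ∫ y : (EuclideanSpace ℝ (Fin 3)), Real.smoothTransition (a + 1 - (√(1 + ‖y‖ ^ 2) + t)) * q t y :=
          setIntegral_le_integral (integrable_coneProfile_bracket_mul a t (hqs t).continuous)
            (Eventually.of_forall fun y => mul_nonneg (coneProfile_nonneg _ _) (hpos t ht y))
  linarith

end ConeCharge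

end Literature.Barriers.QuantumFields
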